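import Summits.BirchSwinnertonDyer.BirchSwinnertonDyer.Theorems.ThetaPartnerAtTwoSignedControlAtTwoOfPoitouTateFour
import Summits.BirchSwinnertonDyer.BirchSwinnertonDyer.Theorems.ThetaPartnerAtTwoSignedControlAtTwoShaTwoPrimaryVanishingTotallyReal
import Summits.BirchSwinnertonDyer.BirchSwinnertonDyer.Theorems.ThetaPartnerAtTwoSignedControlAtTwoStubPoitouTateTwoRealRat
import HarnessLib

/-!
# K4 `SignedControlAtTwo` BY NAME from THREE generic Poitou–Tate facts over `ℚ` (Cor. 4.16 discharged)

Route `ThetaPartnerAtTwo` (TP2; crux shared with `ResidualThetaTransportAtTwo`), crux K4 `SignedControlAtTwo`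
(stmt-BirchSwinnertonDyer-20309), line `eulerchar` v12 (sha16 `d717d3b34c614243`).  Seat `prover-bsd-wall-tp2-p3-w2`
(width seat 2/3, gen 6).

The door of gen 5 (`SignedEC.Door.signedControlAtTwo_of_poitouTate_four`, file `…OfPoitouTateFour`) derives both route
copies of K4 from the four generic named facts `poitouTate_selmerStructure_duality ℚ` (Milne I 4.10(b)),
`poitouTate_sha_tateDual ℚ` (4.10(a)), `poitouTate_three_realPlaces_injective ℚ` (4.10(c)₃) and
`poitouTate_two_realPlaces_surjective ℚ` (Cor. 4.16).  The last one is now a THEOREM for every number field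
(`Literature.NumberTheory.GaloisCohomology.poitouTate_two_realPlaces_surjective_holds`, file
`GaloisCohomology/PoitouTateTwoRealPlacesSurjectiveHolds.lean`; carry cocycle of a Kummer sign character, no class field
theory), so this file records the **three-fact doors**:

* `SignedEC.Door.signedControlAtTwo_of_poitouTate_three` / `signedControlAtTwo_rtt_of_poitouTate_three` — both route
  copies of K4 from `{PT(b), PT(a), 4.10(c)₃}(ℚ)`;
* `SignedEC.Door.signedControl_body_of_poitouTate_three` — the unfolded body;
* `SignedEC.ShaTwo.forall_mem_shaTwo_primary_eq_zero_of_isTotallyReal_of_three` — `Ш²(K, E[p^∞]) = 0` over a totally real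
  `K` (any `p`, `E(K)[p] = 0`, `Sel_{p^∞}` finite) from `{PT(a), 4.10(c)₃}(K)` only.

Residue of K4 of record after this file: the three class-field-theoretic facts above (Tate–Nakayama on the idele class
formation for (a),(b); the strict-cohomological-dimension statement for (c)₃).  BSD is not proved by this file.
-/

set_option autoImplicit false
-- the Theorems namespace of this sub repeats the summit name by design (D-0017 nested layout)
set_option linter.dupNamespace false

noncomputable section

open scoped Classical NumberField

open NumberField IsDedekindDomain Field WeierstrassCurve
open Literature.NumberTheory.EllipticCurves Literature.NumberTheory.GaloisRepresentations
open Literature.NumberTheory.GaloisRepresentations.DiscreteGaloisModule (shaTwo)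
open Literature.NumberTheory.GaloisCohomology
open Summit.BirchSwinnertonDyer.Rank1Residual.X11b (LocBridge.primaryGaloisModule)

namespace Summit.BirchSwinnertonDyer.BirchSwinnertonDyer.Theorems.SignedEC

/-! ### `Ш² = 0` over totally real fields from two facts -/

namespace ShaTwo

variable {K : Type} [Field K] [NumberField K] (W : WeierstrassCurve K) [W.IsElliptic] (p : ℕ) [Fact p.Prime]

/-- **`Ш²(K, E[p^∞]) = 0` over a totally real number field `K`** when `E(K)[p] = 0` and `Sel_{p^∞}(E/K)` is finite, granted
only `poitouTate_sha_tateDual K` (Milne I 4.10(a)) and `poitouTate_three_realPlaces_injective K` (4.10(c)₃) — the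
archimedean surjectivity row (Cor. 4.16) of the gen-5 statement `forall_mem_shaTwo_primary_eq_zero_of_isTotallyReal` is
now the theorem `poitouTate_two_realPlaces_surjective_holds K`.
[cite: MilneADT2006, Ch. I, Thm. 4.10(a),(c), Cor. 4.16, Thm. 6.13(c)] [cite: GreenbergLNM1716, §4 p. 119] -/
theorem forall_mem_shaTwo_primary_eq_zero_of_isTotallyReal_of_three [IsTotallyReal K]
    (hPT : poitouTate_sha_tateDual K) (h3 : poitouTate_three_realPlaces_injective K)
    (hK : ∀ P : W.toAffine.Point, p • P = 0 → P = 0) [Finite (W.selmerGroupPInfty p)] :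
    ∀ c ∈ shaTwo (LocBridge.primaryGaloisModule W p), c = 0 :=
  forall_mem_shaTwo_primary_eq_zero_of_isTotallyReal W p hPT h3 (poitouTate_two_realPlaces_surjective_holds K) hK

end ShaTwo

/-! ### The three-fact doors for K4 -/

namespace Door

/-- **The body of K4 `SignedControlAtTwo` from THREE generic Poitou–Tate facts over `ℚ`** (PT(b), PT(a), 4.10(c)₃):
the gen-5 four-fact body with Cor. 4.16 supplied by `poitouTate_two_realPlaces_surjective_holds ℚ`.
[cite: MilneADT2006, Ch. I, Thm. 4.10, Cor. 4.16] [cite: Kobayashi2003, Thm. 1.2] [cite: GreenbergLNM1716, Prop. 4.13] -/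
theorem signedControl_body_of_poitouTate_three (hPTb : poitouTate_selmerStructure_duality ℚ)
    (hPTa : poitouTate_sha_tateDual ℚ) (h3 : poitouTate_three_realPlaces_injective ℚ)
    (W : WeierstrassCurve ℚ) [W.IsElliptic] [W.IsGloballyMinimal]
    (hss : Rank1Residual.GoodSS W 2) (ha : W.frobeniusTrace 2 = 0) :
    (∀ (κ : ZpExtension ℚ 2) (γ : Field.absoluteGaloisGroup ℚ), κ.IsCyclotomic → κ.IsTopGenerator γ →
        ∀ D : Kobayashi2003.SignedSelmerDualData W κ γ 1, Module.Finite (IwasawaAlgebra 2) D.X) ∧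
      (∀ (κ : ZpExtension ℚ 2) (γ : Field.absoluteGaloisGroup ℚ), κ.IsCyclotomic → κ.IsTopGenerator γ →
        ∀ (D : Kobayashi2003.SignedSelmerDualData W κ γ 1) [Module.Finite (IwasawaAlgebra 2) D.X],
          Module.IsTorsion (IwasawaAlgebra 2) D.X → ∀ g : IwasawaAlgebra 2, D.charIdeal = Ideal.span {g} →
          Finite (W.selmerGroupPInfty 2) →
          ∃ u : ℤ_[2]ˣ, ((PowerSeries.constantCoeff g : ℤ_[2]) : ℚ_[2]) =
            ((u : ℤ_[2]) : ℚ_[2]) * ((2 : ℕ) : ℚ_[2]) ^ (padicValNat 2 W.tamagawaProduct) *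
              (Nat.card (W.selmerGroupPInfty 2) : ℚ_[2])) :=
  signedControl_body_of_poitouTate_four hPTb hPTa h3 (poitouTate_two_realPlaces_surjective_holds ℚ) W hss ha

/-- **K4 `SignedControlAtTwo` (route `ThetaPartnerAtTwo`) BY NAME from THREE generic Poitou–Tate facts over `ℚ`.**
[cite: MilneADT2006, Ch. I, Thm. 4.10, Cor. 4.16] [cite: Kobayashi2003, Thm. 1.2] -/
theorem signedControlAtTwo_of_poitouTate_three (hPTb : poitouTate_selmerStructure_duality ℚ)
    (hPTa : poitouTate_sha_tateDual ℚ) (h3 : poitouTate_three_realPlaces_injective ℚ) :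
    Summit.BirchSwinnertonDyer.BirchSwinnertonDyer.Theses.ThetaPartnerAtTwo.SignedControlAtTwo :=
  signedControlAtTwo_of_poitouTate_four hPTb hPTa h3 (poitouTate_two_realPlaces_surjective_holds ℚ)

/-- **K4 `SignedControlAtTwo` (route `ResidualThetaTransportAtTwo` copy) BY NAME from THREE generic Poitou–Tate facts
over `ℚ`.** [cite: MilneADT2006, Ch. I, Thm. 4.10, Cor. 4.16] [cite: Kobayashi2003, Thm. 1.2] -/
theorem signedControlAtTwo_rtt_of_poitouTate_three (hPTb : poitouTate_selmerStructure_duality ℚ)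
    (hPTa : poitouTate_sha_tateDual ℚ) (h3 : poitouTate_three_realPlaces_injective ℚ) :
    Summit.BirchSwinnertonDyer.BirchSwinnertonDyer.Theses.ResidualThetaTransportAtTwo.SignedControlAtTwo :=
  signedControlAtTwo_rtt_of_poitouTate_four hPTb hPTa h3 (poitouTate_two_realPlaces_surjective_holds ℚ)

end Door

end Summit.BirchSwinnertonDyer.BirchSwinnertonDyer.Theorems.SignedEC

end
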